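import Summits.QuantumAdvantage.QuantumAdvantage.Theorems.PurityDialLawF

/-! # PurityDialLawG — part 7/13 (mechanical split for landing of `PurityDialLaw`; content verbatim; scopes re-opened with their variables) -/

set_option linter.dupNamespace false
noncomputable section

namespace Summit.QuantumAdvantage.QuantumAdvantage.Theorems.PurityDialLaw
open Classical Finset Summit.QuantumAdvantage.AdviceFreeQNC0
open Literature.Computability.MetaComplexity Literature.Computability.MetaComplexity.Smolensky
open Literature.Computability.Complexity (parityFn)

section Tensor

variable {k r : ℕ}

/-- conjunction of `g` on the leading `k` coordinates and `h` on the trailing `r` coordinates. -/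
def tensor (g : (Fin k → Bool) → Bool) (h : (Fin r → Bool) → Bool) : (Fin (k + r) → Bool) → Bool :=
  fun z => g (fun i => z (Fin.castAdd r i)) && h (fun j => z (Fin.natAdd k j))

/-- Purity-dial helper `tensor_append` (lens-4 g6 PurityDialLaw v12 twin; see the enclosing section docstring). -/
theorem tensor_append (g : (Fin k → Bool) → Bool) (h : (Fin r → Bool) → Bool) (y : Fin k → Bool) (u : Fin r → Bool) :
    tensor g h (Fin.append y u) = (g y && h u) := by
  unfold tensor
  simp only [Fin.append_left, Fin.append_right]

/-- Purity-dial helper `fibrePart_tensor` (lens-4 g6 PurityDialLaw v12 twin; see the enclosing section docstring). -/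
theorem fibrePart_tensor (g : (Fin k → Bool) → Bool) (h : (Fin r → Bool) → Bool) (u : Fin r → Bool) (b : Bool) :
    fibrePart (tensor g h) u b =
      if h u = true then (univ.filter fun y : Fin k → Bool => g y = true ∧ parityFn k y = b).card else 0 := by
  unfold fibrePart
  by_cases hu : h u = true
  · rw [if_pos hu]
    congr 1; ext y; simp only [mem_filter, mem_univ, true_and, tensor_append, hu, Bool.and_true]
  · rw [if_neg hu]
    have he : (univ.filter fun y : Fin k → Bool => tensor g h (Fin.append y u) = true ∧ parityFn k y = b) = ∅ :=
      Finset.filter_eq_empty_iff.mpr fun y _ hy => hu (by rw [tensor_append, Bool.and_eq_true] at hy; exact hy.1.2)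
    rw [he, card_empty]

/-- **parts of a tensor**: `O = E_g·O_h + O_g·E_h`. -/
theorem card_oddPart_tensor (g : (Fin k → Bool) → Bool) (h : (Fin r → Bool) → Bool) :
    (oddPart (tensor g h)).card =
      (evenPart g).card * (oddPart h).card + (oddPart g).card * (evenPart h).card := by
  have hsplit : ∀ u : Fin r → Bool, fibrePart (tensor g h) u (xor true (parityFn r u)) =
      (if h u = true ∧ parityFn r u = true then (evenPart g).card else 0) +
      (if h u = true ∧ parityFn r u = false then (oddPart g).card else 0) := by
    intro u
    rw [fibrePart_tensor]
    unfold evenPart oddPart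
    rcases Bool.eq_false_or_eq_true (parityFn r u) with hpu | hpu <;> by_cases hu : h u = true <;> simp [hpu, hu]
  unfold oddPart
  rw [card_part_eq_sum_fibre (tensor g h) true, Finset.sum_congr rfl (fun u _ => hsplit u), Finset.sum_add_distrib,
    ← Finset.sum_filter, Finset.sum_const, smul_eq_mul, ← Finset.sum_filter, Finset.sum_const, smul_eq_mul]
  unfold oddPart evenPart
  ring

/-- **parts of a tensor**: `E = O_g·O_h + E_g·E_h`. -/
theorem card_evenPart_tensor (g : (Fin k → Bool) → Bool) (h : (Fin r → Bool) → Bool) :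
    (evenPart (tensor g h)).card =
      (oddPart g).card * (oddPart h).card + (evenPart g).card * (evenPart h).card := by
  have hsplit : ∀ u : Fin r → Bool, fibrePart (tensor g h) u (xor false (parityFn r u)) =
      (if h u = true ∧ parityFn r u = true then (oddPart g).card else 0) +
      (if h u = true ∧ parityFn r u = false then (evenPart g).card else 0) := by
    intro u
    rw [fibrePart_tensor]
    unfold evenPart oddPart
    rcases Bool.eq_false_or_eq_true (parityFn r u) with hpu | hpu <;> by_cases hu : h u = true <;> simp [hpu, hu]
  unfold evenPart
  rw [card_part_eq_sum_fibre (tensor g h) false, Finset.sum_congr rfl (fun u _ => hsplit u), Finset.sum_add_distrib,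
    ← Finset.sum_filter, Finset.sum_const, smul_eq_mul, ← Finset.sum_filter, Finset.sum_const, smul_eq_mul]
  unfold oddPart evenPart
  ring

/-- **ONE balanced factor balances the tensor** (relative bias multiplies). -/
theorem relBal_tensor_left {R : ℕ} (g : (Fin k → Bool) → Bool) (h : (Fin r → Bool) → Bool) (hg : RelBal R g) :
    RelBal R (tensor g h) := by
  have h1 : (oddPart g).card ≤ R * (evenPart g).card := hg.1
  have h2 : (evenPart g).card ≤ R * (oddPart g).card := hg.2
  unfold RelBal
  rw [card_oddPart_tensor, card_evenPart_tensor]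
  have a1 := Nat.mul_le_mul_right (oddPart h).card h2
  have a2 := Nat.mul_le_mul_right (evenPart h).card h1
  have a3 := Nat.mul_le_mul_right (oddPart h).card h1
  have a4 := Nat.mul_le_mul_right (evenPart h).card h2
  constructor <;> nlinarith [a1, a2, a3, a4]

/-- Purity-dial helper `relBal_tensor_right` (lens-4 g6 PurityDialLaw v12 twin; see the enclosing section docstring). -/
theorem relBal_tensor_right {R : ℕ} (g : (Fin k → Bool) → Bool) (h : (Fin r → Bool) → Bool) (hh : RelBal R h) :
    RelBal R (tensor g h) := by
  have h1 : (oddPart h).card ≤ R * (evenPart h).card := hh.1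
  have h2 : (evenPart h).card ≤ R * (oddPart h).card := hh.2
  unfold RelBal
  rw [card_oddPart_tensor, card_evenPart_tensor]
  have a1 := Nat.mul_le_mul_left (evenPart g).card h1
  have a2 := Nat.mul_le_mul_left (oddPart g).card h2
  have a3 := Nat.mul_le_mul_left (oddPart g).card h1
  have a4 := Nat.mul_le_mul_left (evenPart g).card h2
  constructor <;> nlinarith [a1, a2, a3, a4]

/-- the restriction of a degree-`d` indicator to a fibre of the TRAILING block has degree `≤ d`. -/
theorem fibre_mem_lowDeg_right (p : ℕ) [Fact p.Prime] {d : ℕ} {f : (Fin (k + r) → Bool) → Bool} (hf : HasDegF p f d)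
    (y : Fin k → Bool) :
    (fun u : Fin r → Bool => if f (Fin.append y u) = true then (1 : ZMod p) else 0) ∈ lowDeg (ZMod p) r d := by
  have hcoord : ∀ i : Fin (k + r),
      (fun u : Fin r → Bool => if Fin.append y u i = true then (1 : ZMod p) else 0) ∈ lowDeg (ZMod p) r 1 := by
    intro i
    induction i using Fin.addCases with
    | left j =>
      by_cases hy : y j = true
      · have : (fun u : Fin r → Bool => if Fin.append y u (Fin.castAdd r j) = true then (1 : ZMod p) else 0) = 1 := by
          funext u; rw [Fin.append_left, if_pos hy]; rfl
        rw [this]; exact one_mem_lowDeg 1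
      · have : (fun u : Fin r → Bool => if Fin.append y u (Fin.castAdd r j) = true then (1 : ZMod p) else 0) = 0 := by
          funext u; rw [Fin.append_left, if_neg hy]; rfl
        rw [this]; exact Submodule.zero_mem _
    | right j =>
      have : (fun u : Fin r → Bool => if Fin.append y u (Fin.natAdd k j) = true then (1 : ZMod p) else 0) =
          mono (ZMod p) ({j} : Finset (Fin r)) := by
        funext u; rw [Fin.append_right, mono_apply]; simp
      rw [this]; exact mono_mem_lowDeg (by simp)
  exact Smolensky.comp_mem_lowDeg_of_coord (fun u : Fin r → Bool => Fin.append y u) hcoord hf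

/-- **factors of a satisfiable tensor have degree `≤` the tensor's** (restriction to a fibre). -/
theorem hasDegF_tensor_left (p : ℕ) [Fact p.Prime] {d : ℕ} {g : (Fin k → Bool) → Bool} {h : (Fin r → Bool) → Bool}
    (hf : HasDegF p (tensor g h) d) {u : Fin r → Bool} (hu : h u = true) : HasDegF p g d := by
  have h1 := fibre_mem_lowDeg p hf u
  have e : (fun y : Fin k → Bool => if tensor g h (Fin.append y u) = true then (1 : ZMod p) else 0) =
      fun y => if g y = true then (1 : ZMod p) else 0 := by
    funext y; rw [tensor_append, hu, Bool.and_true]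
  rw [e] at h1
  exact h1

/-- Purity-dial helper `hasDegF_tensor_right` (lens-4 g6 PurityDialLaw v12 twin; see the enclosing section docstring). -/
theorem hasDegF_tensor_right (p : ℕ) [Fact p.Prime] {d : ℕ} {g : (Fin k → Bool) → Bool} {h : (Fin r → Bool) → Bool}
    (hf : HasDegF p (tensor g h) d) {y : Fin k → Bool} (hy : g y = true) : HasDegF p h d := by
  have h1 := fibre_mem_lowDeg_right p hf y
  have e : (fun u : Fin r → Bool => if tensor g h (Fin.append y u) = true then (1 : ZMod p) else 0) =
      fun u => if h u = true then (1 : ZMod p) else 0 := by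
    funext u; rw [tensor_append, hy, Bool.true_and]
  rw [e] at h1
  exact h1

end Tensor

section Certificates

variable {m : ℕ}

/-- an empty level set is balanced. -/
theorem relBal_of_forall_false {R : ℕ} {f : (Fin m → Bool) → Bool} (h : ∀ z, f z = false) : RelBal R f := by
  have h1 : oddPart f = ∅ := by
    unfold oddPart; ext z; simp [h z]
  have h2 : evenPart f = ∅ := by
    unfold evenPart; ext z; simp [h z]
  unfold RelBal
  rw [h1, h2, card_empty]
  exact ⟨Nat.zero_le _, Nat.zero_le _⟩

/-- **a FREE coordinate forces exact balance**: if flipping coordinate `j` never changes `f`, then `#odd = #even`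
(the flip is a parity-switching involution of the level set). -/
theorem parts_eq_of_free {f : (Fin m → Bool) → Bool} (j : Fin m)
    (hfree : ∀ z, f (Function.update z j (!z j)) = f z) : (oddPart f).card = (evenPart f).card := by
  have hφφ : ∀ z : Fin m → Bool, Function.update (Function.update z j (!z j)) j
      (!(Function.update z j (!z j)) j) = z := by
    intro z; funext i
    by_cases hi : i = j
    · subst hi; simp
    · simp [hi]
  refine Finset.card_bij' (fun z _ => Function.update z j (!z j)) (fun z _ => Function.update z j (!z j))
    ?_ ?_ ?_ ?_
  · intro z hz
    unfold oddPart at hz; unfold evenPart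
    rw [mem_filter] at hz ⊢
    refine ⟨mem_univ _, ?_, ?_⟩
    · rw [hfree]; exact hz.2.1
    · rw [Summit.QuantumAdvantage.QuantumAdvantage.Theorems.PairFreezing.parityFn_update_not, hz.2.2]; rfl
  · intro z hz
    unfold evenPart at hz; unfold oddPart
    rw [mem_filter] at hz ⊢
    refine ⟨mem_univ _, ?_, ?_⟩
    · rw [hfree]; exact hz.2.1
    · rw [Summit.QuantumAdvantage.QuantumAdvantage.Theorems.PairFreezing.parityFn_update_not, hz.2.2]; rfl
  · intro z _; exact hφφ z
  · intro z _; exact hφφ z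

/-- **`ANDCert t f`**: `f` contains a LITERAL COPY of the conjunction `AND_t` — a literal map `E : {0,1}^t → {0,1}^m` with
`f ∘ E = AND_t` (the degree certificate of the tensor closure). -/
def ANDCert (t : ℕ) : Set ((Fin m → Bool) → Bool) := fun f =>
  ∃ E : (Fin t → Bool) → (Fin m → Bool), IsLiteralMap E ∧ ∀ y, f (E y) = decide (∀ i, y i = true)

/-- **the certificate bounds the degree from below**: `ANDCert t f`, `deg f ≤ d` ⇒ `t ≤ d` — the alternating sum of `AND_t` over
the `t`-cube is `±1`, not `0` (`Summit.QuantumAdvantage.QuantumAdvantage.Theorems.PairFreezing.altSum_eq_zero`). -/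
theorem le_of_andCert (p : ℕ) [Fact p.Prime] {t d : ℕ} {f : (Fin m → Bool) → Bool} (hc : ANDCert t f)
    (hf : HasDegF p f d) : t ≤ d := by
  obtain ⟨E, hE, hAND⟩ := hc
  by_contra hlt
  have hdeg : HasDegF p (fun y => f (E y)) d := hasDegF_comp_literal hf hE
  have h0 : ∑ y : Fin t → Bool, (if parityFn t y = true then (-1 : ZMod p) else 1) *
      (if f (E y) = true then (1 : ZMod p) else 0) = 0 := Summit.QuantumAdvantage.QuantumAdvantage.Theorems.PairFreezing.altSum_eq_zero p (not_le.1 hlt) hdeg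
  rw [Finset.sum_eq_single (fun _ : Fin t => true)] at h0
  · have htrue : f (E fun _ => true) = true := by rw [hAND]; simp
    rw [htrue, if_pos rfl, mul_one] at h0
    split_ifs at h0 with hpar
    · exact one_ne_zero (neg_eq_zero.1 h0)
    · exact one_ne_zero h0
  · intro y _ hy
    have hfalse : f (E y) = false := by
      rw [hAND, decide_eq_false_iff_not]
      intro hall
      exact hy (funext fun i => hall i)
    rw [hfalse]; simp
  · intro h; exact absurd (mem_univ _) h

/-- the constant-true function on the `0`-cube has the empty certificate. -/
theorem andCert_zero {f : (Fin m → Bool) → Bool} (h : ∀ z, f z = true) : ANDCert 0 f := by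
  refine ⟨fun _ _ => false, fun j => ⟨false, Or.inl fun _ => rfl⟩, fun y => ?_⟩
  rw [h]; simp

/-- **a non-constant Boolean function has a SENSITIVE EDGE** (walk from a `1`-point to a `0`-point). -/
theorem exists_sensitive {f : (Fin m → Bool) → Bool} {a b : Fin m → Bool} (ha : f a = true) (hb : f b = false) :
    ∃ (z : Fin m → Bool) (j : Fin m), f z = true ∧ f (Function.update z j (!z j)) = false := by
  suffices H : ∀ n : ℕ, ∀ a : Fin m → Bool, (univ.filter fun i => a i ≠ b i).card = n → f a = true →
      ∃ (z : Fin m → Bool) (j : Fin m), f z = true ∧ f (Function.update z j (!z j)) = false from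
    H _ a rfl ha
  intro n
  induction n with
  | zero =>
    intro a hn hfa
    have hab : a = b := by
      funext i
      by_contra hi
      have hmem : i ∈ (univ.filter fun i => a i ≠ b i) := by rw [mem_filter]; exact ⟨mem_univ _, hi⟩
      exact Finset.card_ne_zero_of_mem hmem hn
    rw [hab, hb] at hfa
    exact absurd hfa (by decide)
  | succ n ih =>
    intro a hn hfa
    obtain ⟨i, hi⟩ : (univ.filter fun i => a i ≠ b i).Nonempty := by
      rw [← card_pos, hn]; exact Nat.succ_pos n
    rw [mem_filter] at hi
    by_cases hstep : f (Function.update a i (!a i)) = false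
    · exact ⟨a, i, hfa, hstep⟩
    · have hstep' : f (Function.update a i (!a i)) = true := by
        cases hv : f (Function.update a i (!a i))
        · exact absurd hv hstep
        · rfl
      refine ih (Function.update a i (!a i)) ?_ hstep'
      have hset : (univ.filter fun l => Function.update a i (!a i) l ≠ b l) =
          (univ.filter fun l => a l ≠ b l).erase i := by
        ext l
        rw [mem_erase, mem_filter, mem_filter]
        by_cases hl : l = i
        · subst hl
          have : (!a l) = b l := by
            have h2 := hi.2
            cases ha' : a l <;> cases hb' : b l <;> simp_all
          simp [this]
        · simp [hl]
      rw [hset, card_erase_of_mem (by rw [mem_filter]; exact hi), hn]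
      rfl

/-- hence a non-constant function carries `ANDCert 1`. -/
theorem andCert_one {f : (Fin m → Bool) → Bool} {a b : Fin m → Bool} (ha : f a = true) (hb : f b = false) :
    ANDCert 1 f := by
  obtain ⟨z, j, hz, hz'⟩ := exists_sensitive ha hb
  refine ⟨fun y => if y 0 = true then z else Function.update z j (!z j), fun l => ?_, fun y => ?_⟩
  · by_cases hl : l = j
    · subst hl
      refine ⟨!z l, Or.inr ⟨0, fun y => ?_⟩⟩
      show (if y 0 = true then z else Function.update z l (!z l)) l = xor (!z l) (y 0)
      cases hy : y 0 <;> simp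
    · refine ⟨z l, Or.inl fun y => ?_⟩
      show (if y 0 = true then z else Function.update z j (!z j)) l = z l
      by_cases hy : y 0 = true
      · rw [if_pos hy]
      · rw [if_neg hy, Function.update_of_ne hl]
  · have hiff : (∀ i : Fin 1, y i = true) ↔ y 0 = true :=
      ⟨fun H => H 0, fun H i => by rw [Subsingleton.elim i 0]; exact H⟩
    show f (if y 0 = true then z else Function.update z j (!z j)) = decide (∀ i : Fin 1, y i = true)
    by_cases hy : y 0 = true
    · rw [if_pos hy, hz]; symm; rw [decide_eq_true_iff, hiff]; exact hy
    · rw [if_neg hy, hz']; symm; rw [decide_eq_false_iff_not, hiff]; exact hy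

/-- certificates tensor: `ANDCert s g`, `ANDCert t h` ⇒ `ANDCert (s + t) (tensor g h)`. -/
theorem andCert_tensor {k r s t : ℕ} {g : (Fin k → Bool) → Bool} {h : (Fin r → Bool) → Bool}
    (hg : ANDCert s g) (hh : ANDCert t h) : ANDCert (s + t) (tensor g h) := by
  obtain ⟨Eg, hEg, hg⟩ := hg
  obtain ⟨Eh, hEh, hh⟩ := hh
  refine ⟨fun y => Fin.append (Eg fun i => y (Fin.castAdd t i)) (Eh fun j => y (Fin.natAdd s j)), fun l => ?_,
    fun y => ?_⟩
  · induction l using Fin.addCases with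
    | left jj =>
      obtain ⟨b, hb⟩ := hEg jj
      refine ⟨b, ?_⟩
      rcases hb with hc | ⟨kk, hk⟩
      · exact Or.inl fun y => by dsimp only; rw [Fin.append_left, hc]
      · exact Or.inr ⟨Fin.castAdd t kk, fun y => by dsimp only; rw [Fin.append_left, hk]⟩
    | right jj =>
      obtain ⟨b, hb⟩ := hEh jj
      refine ⟨b, ?_⟩
      rcases hb with hc | ⟨kk, hk⟩
      · exact Or.inl fun y => by dsimp only; rw [Fin.append_right, hc]
      · exact Or.inr ⟨Fin.natAdd s kk, fun y => by dsimp only; rw [Fin.append_right, hk]⟩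
  · show tensor g h (Fin.append (Eg fun i => y (Fin.castAdd t i)) (Eh fun j => y (Fin.natAdd s j))) = _
    rw [tensor_append, hg, hh]
    have hiff : (∀ i : Fin (s + t), y i = true) ↔
        (∀ i : Fin s, y (Fin.castAdd t i) = true) ∧ (∀ j : Fin t, y (Fin.natAdd s j) = true) :=
      ⟨fun H => ⟨fun i => H _, fun j => H _⟩,
       fun H i => Fin.addCases (motive := fun i => y i = true) H.1 H.2 i⟩
    by_cases h1 : ∀ i : Fin s, y (Fin.castAdd t i) = true <;>
      by_cases h2 : ∀ j : Fin t, y (Fin.natAdd s j) = true <;> simp [h1, h2, hiff]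

/-- certificates are invariant under relabelling. -/
theorem andCert_permFn {t : ℕ} (σ : Equiv.Perm (Fin m)) {f : (Fin m → Bool) → Bool} (hc : ANDCert t f) :
    ANDCert t (permFn σ f) := by
  obtain ⟨E, hE, hf⟩ := hc
  refine ⟨fun y => fun i => E y (σ.symm i), fun l => ?_, fun y => ?_⟩
  · obtain ⟨b, hb⟩ := hE (σ.symm l)
    exact ⟨b, hb⟩
  · unfold permFn
    have : (fun i => E y (σ.symm (σ i))) = E y := by funext i; rw [Equiv.symm_apply_apply]
    rw [this, hf]

end Certificates


end Summit.QuantumAdvantage.QuantumAdvantage.Theorems.PurityDialLaw
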